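import Summits.AtomisticToContinuum.Crystallization.Theorems.ChartedZeroExcessLayeredLatticeLiouvilleZZZYRCXRWE

/-!
# Charted zero-excess layered-lattice Liouville — ZZZYRCXRWHB: the angle comparison and the K-file templates WITHOUT the height check `hhb`

Cell `decomp-a2c`, lens 2, generation 101 (census FINDING «HHB-26636», critic r1917 (B)(3)).  The landed angle comparison lemma ZZZYRCZP
`idealAngleCmpF_of_slabBoxF` and its three consumers (ZZZYRCZZ `nearF_of_inBoxWH`, `boxTailDebitP_of_inBoxWH`; ZZZYRCXRWE
`nearF_of_inBoxWH_E`, `boxTailDebitP_of_inBoxWH_E`) carry the side condition `hhb : 3·(hLo + hHi)² ≤ 8·(1 + s)²` (mean height ratio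
`ρ_h ≤ 1 + s`), which fails on the 32 ATLAS-D cells with `ρ_h ≥ 1.03`.  The condition is a PROOF-ROUTE ARTEFACT: it enters ZZZYRCZP
`angle_core` at exactly one step (`hY`: the mean-height stretch of the normal component is majorised by the conformal ceiling `(1+s)·a` so
that the in-plane and the normal parts share the factor `a²(1+s)²` in `K`).  It is traded here for a K-factor, with NO new geometry: the slab box
is monotone in the conformal tolerance (`SlabBoxF ℓ aLo aHi s … → SlabBoxF ℓ aLo aHi s' …` for `s ≤ s'`, since `‖L − a•Q‖ ≤ s·a ≤ s'·a`), so the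
landed lemma applied at any `s' ≥ s` with `3·(hLo + hHi)² ≤ 8·(1 + s')²` gives

  `IdealAngleCmpF ℓ ((1+β)·((1+s')·aHi/λ)²) (6·(1+β⁻¹)·(aHi/λ)²·(τ² + (hHi − hLo)²/4)) (gen₁ L) (gen₂ L) w`

— `K` acquires the factor `((1+s')/(1+s))²`, optimal `(1+s')² = max((1+s)², (3/8)·(hLo+hHi)²)`, i.e.
`K = (1+β)·max((1+s)², 3(hLo+hHi)²/8)·(aHi/λ)²`; `η` is UNCHANGED; the LENGTH side (the five checks, `λ`, `μ`) stays at the true `s`.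
At `ρ_h = 1.03` (`hLo + hHi = 1.682`): `s' = 0.031`, K-factor `1.022`; at `ρ_h = 1.094` (`hLo + hHi ≈ 1.7865`): `s' = 0.095`, K-factor `1.152`.

Contents: §1 tolerance monotonicity (`isConfChart_mono_tol`, `slabBoxF_mono_tol`) and ★ `idealAngleCmpF_of_slabBoxF_hb`; §2 the
`hhb`-free editions of the two ZZZYRCZZ templates (exact kernel certificates `KernelSlabSoundF`): `nearF_of_inBoxWH_hb`,
★ `boxTailDebitP_of_inBoxWH_hb`; §3 the same on existential-data certificates `KernelSlabSoundFE` (ZZZYRCXRWE): `nearF_of_inBoxWH_E_hb`,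
★ `boxTailDebitP_of_inBoxWH_E_hb`.  Every edition has the binders of its original with `hhb` replaced by `(hss' : s ≤ s')
(hhb' : 3·(hLo+hHi)² ≤ 8·(1+s')²)` and `hKa` stated with `s'`; conclusions are byte-identical to the originals (same tables, same `Ka`, `ηa`
binders), so the door of record consumes them unchanged.  The originals are the case `s' = s` (sanity `example`s).
-/

namespace Summit.AtomisticToContinuum.Crystallization.Theorems.ChartedZeroExcessLayeredLatticeLiouville

open scoped BigOperators RealInnerProductSpace
open Summit.AtomisticToContinuum.Crystallization.Theorems.ChartedPlanarOrderRigidityDoor (E3)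

/-! ### §1 tolerance monotonicity and the `hhb`-free angle comparison -/

/-- an `s`-conformal chart about `a ≥ 0` is `s'`-conformal for every `s' ≥ s`. [g101] -/
theorem isConfChart_mono_tol {a s s' : ℝ} {L : E3 →L[ℝ] E3} (h : IsConfChart a s L) (ha : 0 ≤ a) (hss' : s ≤ s') :
    IsConfChart a s' L := by
  obtain ⟨Q, hQ⟩ := h
  exact ⟨Q, hQ.trans (mul_le_mul_of_nonneg_right hss' ha)⟩

/-- the slab box is monotone in the conformal tolerance: `SlabBoxF ℓ aLo aHi s … → SlabBoxF ℓ aLo aHi s' …` for `s ≤ s'` (`0 ≤ aLo`). [g101] -/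
theorem slabBoxF_mono_tol {ℓ : ℤ → ℤ} {aLo aHi s s' τ hLo hHi : ℝ} {L : E3 ≃L[ℝ] E3} {w : ℤ → E3}
    (hB : SlabBoxF ℓ aLo aHi s τ hLo hHi L w) (haLo : 0 ≤ aLo) (hss' : s ≤ s') : SlabBoxF ℓ aLo aHi s' τ hLo hHi L w := by
  obtain ⟨a, n, r, h, haLo', haHi', hconf, hn, hg₁, hg₂, hr, hh, hrn, hstep⟩ := hB
  exact ⟨a, n, r, h, haLo', haHi', isConfChart_mono_tol hconf (haLo.trans haLo') hss', hn, hg₁, hg₂, hr, hh, hrn, hstep⟩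

/-- ★★ THE ANGLE COMPARISON LEMMA WITHOUT `hhb`: for any tolerance `s' ≥ s` with `3(hLo+hHi)² ≤ 8(1+s')²` (always available: take
`(1+s')² = max((1+s)², 3(hLo+hHi)²/8)`), a word in the slab box with a length floor `λ` satisfies `IdealAngleCmpF ℓ K η (gen₁ L) (gen₂ L) w` with
`K = (1+β)((1+s')aHi/λ)²` and the UNCHANGED `η = 6(1+β⁻¹)(aHi/λ)²(τ² + (hHi−hLo)²/4)`; the length floor is the one certified at the true `s`. [g101] -/
theorem idealAngleCmpF_of_slabBoxF_hb {ℓ : ℤ → ℤ} {aLo aHi s s' τ hLo hHi lam mu β : ℝ} {L : E3 ≃L[ℝ] E3} {w : ℤ → E3}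
    (hB : SlabBoxF ℓ aLo aHi s τ hLo hHi L w) (hlen : IdealLengthCmpF ℓ lam mu (gen₁ L) (gen₂ L) w) (haLo : 0 ≤ aLo)
    (hs0 : 0 ≤ s) (hΔ : hLo ≤ hHi) (hss' : s ≤ s') (hhb' : 3 * (hLo + hHi) ^ 2 ≤ 8 * (1 + s') ^ 2) (hlam : 0 < lam) (hβ : 0 < β) :
    IdealAngleCmpF ℓ ((1 + β) * ((1 + s') * aHi / lam) ^ 2) (6 * (1 + β⁻¹) * (aHi / lam) ^ 2 * (τ ^ 2 + (hHi - hLo) ^ 2 / 4))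
      (gen₁ L) (gen₂ L) w :=
  idealAngleCmpF_of_slabBoxF (slabBoxF_mono_tol hB haLo hss') hlen haLo (hs0.trans hss') hΔ hhb' hlam hβ

/-- sanity: the landed lemma is the case `s' = s`. [g101] -/
example {ℓ : ℤ → ℤ} {aLo aHi s τ hLo hHi lam mu β : ℝ} {L : E3 ≃L[ℝ] E3} {w : ℤ → E3}
    (hB : SlabBoxF ℓ aLo aHi s τ hLo hHi L w) (hlen : IdealLengthCmpF ℓ lam mu (gen₁ L) (gen₂ L) w) (haLo : 0 ≤ aLo)
    (hs0 : 0 ≤ s) (hΔ : hLo ≤ hHi) (hhb : 3 * (hLo + hHi) ^ 2 ≤ 8 * (1 + s) ^ 2) (hlam : 0 < lam) (hβ : 0 < β) :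
    IdealAngleCmpF ℓ ((1 + β) * ((1 + s) * aHi / lam) ^ 2) (6 * (1 + β⁻¹) * (aHi / lam) ^ 2 * (τ ^ 2 + (hHi - hLo) ^ 2 / 4))
      (gen₁ L) (gen₂ L) w :=
  idealAngleCmpF_of_slabBoxF_hb hB hlen haLo hs0 hΔ le_rfl hhb hlam hβ

/-- numerics of the two regimes the ATLAS-D cells need: `ρ_h = 1.03` (`hLo + hHi = 1.682`) is served by `s' = 0.031`, and any cell with
`hLo + hHi ≤ 1.788` (`ρ_h ≤ 1.094`) by `s' = 0.095`. [g101] -/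
example : 3 * ((8287 : ℝ) / 10000 + 8533 / 10000) ^ 2 ≤ 8 * (1 + 31 / 1000) ^ 2 ∧
    ∀ hLo hHi : ℝ, 0 ≤ hLo + hHi → hLo + hHi ≤ 1788 / 1000 → 3 * (hLo + hHi) ^ 2 ≤ 8 * (1 + 95 / 1000 : ℝ) ^ 2 := by
  refine ⟨by norm_num, fun hLo hHi h0 h1 => ?_⟩
  nlinarith [mul_le_mul h1 h1 h0 (by norm_num)]

/-! ### §2 the `hhb`-free K-file templates on exact kernel certificates (editions of ZZZYRCZZ) -/

/-- ★ NEAR, per word of the hollow cell, WITHOUT `hhb` (edition of ZZZYRCZZ `nearF_of_inBoxWH`: `hhb ↦ (hss', hhb')`, `hKa` at `s'`; same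
conclusion). [g101] -/
theorem nearF_of_inBoxWH_hb {s s' aLo aHi τ hLo hHi lam mu β Ka ηa ϱ α : ℝ} {H₀ R E : ℕ} {lo hi P9max : ℤ}
    {cdOf : List ℤ → List ChordDatum} {TRX TNX : ℤ × ℤ × ℤ × ℤ → ℤ}
    (haLo : 0 < aLo) (hs0 : 0 ≤ s) (hs1 : s < 1) (hτ : 0 ≤ τ) (hhLo : 0 ≤ hLo) (hhHi : 0 ≤ hHi)
    (hA : lam ^ 2 < (1 - s) ^ 2 * aLo ^ 2)
    (hAC : (1 - s) ^ 2 * τ ^ 2 * aLo ^ 4 ≤ ((1 - s) ^ 2 * aLo ^ 2 - lam ^ 2) * ((τ ^ 2 + hLo ^ 2) * aLo ^ 2 - 2 / 3 * lam ^ 2))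
    (hC2 : lam ^ 2 * (τ ^ 2 + 2 / 3 * (1 - s) ^ 2) ≤ hLo ^ 2 * (1 - s) ^ 2 * aLo ^ 2) (hA' : (1 + s) ^ 2 * aHi ^ 2 < mu ^ 2)
    (hAC' : (1 + s) ^ 2 * τ ^ 2 * aHi ^ 4 ≤ (mu ^ 2 - (1 + s) ^ 2 * aHi ^ 2) * (2 / 3 * mu ^ 2 - (τ ^ 2 + hHi ^ 2) * aHi ^ 2))
    (hΔ : hLo ≤ hHi) (hss' : s ≤ s') (hhb' : 3 * (hLo + hHi) ^ 2 ≤ 8 * (1 + s') ^ 2) (hlam : 0 < lam) (hβ : 0 < β)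
    (hKa : (1 + β) * ((1 + s') * aHi / lam) ^ 2 ≤ Ka) (hηa : 6 * (1 + β⁻¹) * (aHi / lam) ^ 2 * (τ ^ 2 + (hHi - hLo) ^ 2 / 4) ≤ ηa)
    (hϱ : 0 ≤ ϱ) (hα : 0 < α)
    (hT : ∀ ω : List ℤ, ω.length = 2 * H₀ + 1 → IsLetterSeq (regW ω) → IsHollowWindow (2 * H₀ + 1) ω →
      KernelSlabSoundF H₀ R ω lo hi P9max E (cdOf ω) TRX TNX)
    (hP9 : mu ^ 2 * (P9max : ℝ) ≤ 9 * ϱ ^ 2) (hlo : mu ^ 2 * (lo : ℝ) ≤ 9 * ϱ ^ 2) {L : E3 ≃L[ℝ] E3} {w' : ℤ → E3}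
    (hB : InBoxWH s aLo aHi τ hLo hHi L w') :
    IsPathSystemOn ϱ (gen₁ L) (gen₂ L) w' (IdealNearF (letterOfWH s aLo aHi τ hLo hHi L w') hi) (cellNpF H₀ cdOf s aLo aHi τ hLo hHi L w')
        (cellZF H₀ cdOf s aLo aHi τ hLo hHi L w') ∧
      SchemeDominatedOnP ϱ α (gen₁ L) (gen₂ L) w' (cellNpF H₀ cdOf s aLo aHi τ hLo hHi L w') (cellZF H₀ cdOf s aLo aHi τ hLo hHi L w')
        (IdealNearF (letterOfWH s aLo aHi τ hLo hHi L w') hi) (fun y => nearTableR H₀ R E α lam TRX (y.2 - y.1))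
        fun y => nearTableN H₀ R E α lam Ka ηa TRX TNX (y.2 - y.1) := by
  obtain ⟨hℓ, hH, hbox⟩ := letterOfWH_spec hB
  have hL := idealLengthCmpF_of_slabBoxF hbox haLo hs0 hs1 hτ hhLo hhHi hA hAC hC2 hA' hAC'
  have hAng := idealAngleCmpF_mono hKa hηa (idealAngleCmpF_of_slabBoxF_hb hbox hL haLo.le hs0 hΔ hss' hhb' hlam hβ)
  have hK0 : 0 ≤ Ka := le_trans (by positivity) hKa
  have hη0 : 0 ≤ ηa := le_trans (by positivity) hηa
  exact thetaReaderNearF_of_types hℓ (fun m => isHollowWindow_windowWord hH _ _) hϱ hα hlam hK0 hη0 hT hL hAng hP9 hlo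

/-- ★★★ **THE HOLLOW-CELL K-FILE TEMPLATE WITHOUT `hhb`** (edition of ZZZYRCZZ `boxTailDebitP_of_inBoxWH`: `hhb ↦ (hss', hhb')`, `hKa` at
`s'`; every other hypothesis and the CONCLUSION unchanged, so the door of record consumes it as before). [g101] -/
theorem boxTailDebitP_of_inBoxWH_hb {s s' Λ c₀ ℓ₀ aLo aHi τ hLo hHi lam mu β Ka ηa ϱ α D θ cB : ℝ} {H₀ R E : ℕ} {lo hi P9max : ℤ}
    {cdOf : List ℤ → List ChordDatum} {TRX TNX : ℤ × ℤ × ℤ × ℤ → ℤ} {Kx HI1 HI2 Gb Mm nr nD n₁ : ℕ} {yLo : ℤ}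
    (hc : 0 < c₀) (hϱ1 : 1 ≤ ϱ) (hα : 0 < α) (hD : 0 < D) (hcB : 0 < cB) (hcB2 : 2 * cB ^ 2 ≤ lam ^ 2)
    (haLo : 0 < aLo) (hs0 : 0 ≤ s) (hs1 : s < 1) (hτ : 0 ≤ τ) (hhLo : 0 ≤ hLo) (hhHi : 0 ≤ hHi)
    (hA : lam ^ 2 < (1 - s) ^ 2 * aLo ^ 2)
    (hAC : (1 - s) ^ 2 * τ ^ 2 * aLo ^ 4 ≤ ((1 - s) ^ 2 * aLo ^ 2 - lam ^ 2) * ((τ ^ 2 + hLo ^ 2) * aLo ^ 2 - 2 / 3 * lam ^ 2))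
    (hC2 : lam ^ 2 * (τ ^ 2 + 2 / 3 * (1 - s) ^ 2) ≤ hLo ^ 2 * (1 - s) ^ 2 * aLo ^ 2) (hA' : (1 + s) ^ 2 * aHi ^ 2 < mu ^ 2)
    (hAC' : (1 + s) ^ 2 * τ ^ 2 * aHi ^ 4 ≤ (mu ^ 2 - (1 + s) ^ 2 * aHi ^ 2) * (2 / 3 * mu ^ 2 - (τ ^ 2 + hHi ^ 2) * aHi ^ 2))
    (hΔ : hLo ≤ hHi) (hss' : s ≤ s') (hhb' : 3 * (hLo + hHi) ^ 2 ≤ 8 * (1 + s') ^ 2) (hlam : 0 < lam) (hβ : 0 < β)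
    (hKa : (1 + β) * ((1 + s') * aHi / lam) ^ 2 ≤ Ka) (hηa : 6 * (1 + β⁻¹) * (aHi / lam) ^ 2 * (τ ^ 2 + (hHi - hLo) ^ 2 / 4) ≤ ηa)
    (hgen : 2 * ((1 + s) * aHi) + ℓ₀ ≤ ϱ)
    (hT : ∀ ω : List ℤ, ω.length = 2 * H₀ + 1 → IsLetterSeq (regW ω) → IsHollowWindow (2 * H₀ + 1) ω →
      KernelSlabSoundF H₀ R ω lo hi P9max E (cdOf ω) TRX TNX)
    (hP9 : mu ^ 2 * (P9max : ℝ) ≤ 9 * ϱ ^ 2) (hlo : mu ^ 2 * (lo : ℝ) ≤ 9 * ϱ ^ 2)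
    (hKx : 0 < Kx) (slabs : List (ℤ × List (List (ℕ × ℕ)) × List ℕ))
    (hsl : ∀ sl ∈ slabs, xiSlab Kx HI1 HI2 sl.1 yLo sl.2.1 = some sl.2.2 ∧ ∀ c ∈ sl.2.1, c.length = nr)
    (hG : 4 * HI2 < 3 * (3 * (Gb + 1) - 2) ^ 2) (hM : HI2 < 6 * (Mm + 1) * (Mm + 1))
    (hy : ∀ t : ℤ, t.natAbs ≤ Gb → yLo ≤ t ∧ t < yLo + nr)
    (hx : ∀ t : ℤ, t.natAbs ≤ Gb → ∃ sl ∈ slabs, sl.1 ≤ t ∧ t < sl.1 + sl.2.1.length)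
    (h1 : (HI1 : ℤ) ≤ hi) (h2 : 9 * D ^ 2 ≤ lam ^ 2 * (HI2 : ℝ))
    (hnD : (nD : ℝ) - 1 ≤ D / ϱ) (hn2 : 2 ≤ n₁) (hnD₁ : nD ≤ n₁)
    (hθ : ∑ n ∈ Finset.Ico nD n₁, (2 * (n : ℝ) * (n + 1) * (2 * n + 1) / 3) * (7 * (n : ℝ) / D ^ 8) +
        14 * ((n₁ : ℝ) + 1) * (2 * n₁ + 1) / (9 * cB ^ 8 * (n₁ : ℝ) ^ 2 * ((n₁ : ℝ) - 1) ^ 3) ≤ θ) :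
    BoxTailDebitP s Λ c₀ ℓ₀ ϱ (InBoxWH s aLo aHi τ hLo hHi)
      (fun _ _ y => nearTableR H₀ R E α lam TRX (y.2 - y.1) +
        (1 + α) * (lam ^ 8)⁻¹ * (45927 / Kx * (slabs.map fun sl => (sl.2.2.getD (code3 (y.2 - y.1)) 0 : ℝ)).sum) + (1 + α) * θ)
      (fun _ _ y => nearTableN H₀ R E α lam Ka ηa TRX TNX (y.2 - y.1) +
        (1 + α⁻¹) * (lam ^ 8)⁻¹ * (45927 / Kx * (slabs.map fun sl => (sl.2.2.getD (code3 (y.2 - y.1)) 0 : ℝ)).sum) + (1 + α⁻¹) * θ)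
      0 := by
  have hϱ0 : 0 < ϱ := one_pos.trans_le hϱ1
  exact boxTailDebitP_of_scheme hϱ1 hα hc
    (boxSchemeP_of_cover3FBox hα hcB hϱ0 hD hnD hn2 hnD₁ hθ (letterOfWH s aLo aHi τ hLo hHi) hi
      (fun L w' hB => gen_sum_le_of_inBoxWH haLo.le hs0 hgen hB)
      (fun a _ L w' _ hB => isLayeredCrystal_of_inBoxW (inBoxW_of_inBoxWH hB) hcB.le hcB2 haLo hs0 hs1 hτ hhLo hhHi hA hAC hC2
        hA' hAC')
      (fun a _ L w' _ hB => nearF_of_inBoxWH_hb haLo hs0 hs1 hτ hhLo hhHi hA hAC hC2 hA' hAC' hΔ hss' hhb' hlam hβ hKa hηa hϱ0.le hα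
        hT hP9 hlo hB)
      (fun a _ L w' _ hB => midF_of_inBoxWH (ϱ := ϱ) haLo hs0 hs1 hτ hhLo hhHi hA hAC hC2 hA' hAC' hlam hα hKx slabs hsl hG hM hy hx
        h1 h2 hB))

/-! ### §3 the `hhb`-free templates on existential-data certificates (editions of ZZZYRCXRWE) -/

/-- ★ NEAR on existential-data certificates, WITHOUT `hhb` (edition of ZZZYRCXRWE `nearF_of_inBoxWH_E`). [g101] -/
theorem nearF_of_inBoxWH_E_hb {s s' aLo aHi τ hLo hHi lam mu β Ka ηa ϱ α : ℝ} {H₀ R E : ℕ} {lo hi P9max : ℤ}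
    {TRX TNX : ℤ × ℤ × ℤ × ℤ → ℤ}
    (haLo : 0 < aLo) (hs0 : 0 ≤ s) (hs1 : s < 1) (hτ : 0 ≤ τ) (hhLo : 0 ≤ hLo) (hhHi : 0 ≤ hHi)
    (hA : lam ^ 2 < (1 - s) ^ 2 * aLo ^ 2)
    (hAC : (1 - s) ^ 2 * τ ^ 2 * aLo ^ 4 ≤ ((1 - s) ^ 2 * aLo ^ 2 - lam ^ 2) * ((τ ^ 2 + hLo ^ 2) * aLo ^ 2 - 2 / 3 * lam ^ 2))
    (hC2 : lam ^ 2 * (τ ^ 2 + 2 / 3 * (1 - s) ^ 2) ≤ hLo ^ 2 * (1 - s) ^ 2 * aLo ^ 2) (hA' : (1 + s) ^ 2 * aHi ^ 2 < mu ^ 2)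
    (hAC' : (1 + s) ^ 2 * τ ^ 2 * aHi ^ 4 ≤ (mu ^ 2 - (1 + s) ^ 2 * aHi ^ 2) * (2 / 3 * mu ^ 2 - (τ ^ 2 + hHi ^ 2) * aHi ^ 2))
    (hΔ : hLo ≤ hHi) (hss' : s ≤ s') (hhb' : 3 * (hLo + hHi) ^ 2 ≤ 8 * (1 + s') ^ 2) (hlam : 0 < lam) (hβ : 0 < β)
    (hKa : (1 + β) * ((1 + s') * aHi / lam) ^ 2 ≤ Ka) (hηa : 6 * (1 + β⁻¹) * (aHi / lam) ^ 2 * (τ ^ 2 + (hHi - hLo) ^ 2 / 4) ≤ ηa)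
    (hϱ : 0 ≤ ϱ) (hα : 0 < α)
    (hT : ∀ ω : List ℤ, ω.length = 2 * H₀ + 1 → IsLetterSeq (regW ω) → IsHollowWindow (2 * H₀ + 1) ω →
      KernelSlabSoundFE H₀ R ω lo hi P9max E TRX TNX)
    (hP9 : mu ^ 2 * (P9max : ℝ) ≤ 9 * ϱ ^ 2) (hlo : mu ^ 2 * (lo : ℝ) ≤ 9 * ϱ ^ 2) {L : E3 ≃L[ℝ] E3} {w' : ℤ → E3}
    (hB : InBoxWH s aLo aHi τ hLo hHi L w') :
    ∃ (np : (Cell 2 × ℤ) × (Cell 2 × ℤ) → ℕ) (z : (Cell 2 × ℤ) × (Cell 2 × ℤ) → ℕ → Cell 2 × ℤ),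
      IsPathSystemOn ϱ (gen₁ L) (gen₂ L) w' (IdealNearF (letterOfWH s aLo aHi τ hLo hHi L w') hi) np z ∧
        SchemeDominatedOnP ϱ α (gen₁ L) (gen₂ L) w' np z (IdealNearF (letterOfWH s aLo aHi τ hLo hHi L w') hi)
          (fun y => nearTableR H₀ R E α lam TRX (y.2 - y.1)) fun y => nearTableN H₀ R E α lam Ka ηa TRX TNX (y.2 - y.1) := by
  obtain ⟨hℓ, hH, hbox⟩ := letterOfWH_spec hB
  have hL := idealLengthCmpF_of_slabBoxF hbox haLo hs0 hs1 hτ hhLo hhHi hA hAC hC2 hA' hAC'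
  have hAng := idealAngleCmpF_mono hKa hηa (idealAngleCmpF_of_slabBoxF_hb hbox hL haLo.le hs0 hΔ hss' hhb' hlam hβ)
  have hK0 : 0 ≤ Ka := le_trans (by positivity) hKa
  have hη0 : 0 ≤ ηa := le_trans (by positivity) hηa
  obtain ⟨cdW, h⟩ :=
    thetaReaderNearF_of_typesE hℓ (fun m => isHollowWindow_windowWord hH _ _) hϱ hα hlam hK0 hη0 hT hL hAng hP9 hlo
  exact ⟨_, _, h⟩

/-- ★★★ **THE HOLLOW-CELL K-FILE TEMPLATE ON EXISTENTIAL-DATA CERTIFICATES, WITHOUT `hhb`** (edition of ZZZYRCXRWE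
`boxTailDebitP_of_inBoxWH_E`: `hhb ↦ (hss', hhb')`, `hKa` at `s'`; conclusion unchanged). [g101] -/
theorem boxTailDebitP_of_inBoxWH_E_hb {s s' Λ c₀ ℓ₀ aLo aHi τ hLo hHi lam mu β Ka ηa ϱ α D θ cB : ℝ} {H₀ R E : ℕ}
    {lo hi P9max : ℤ} {TRX TNX : ℤ × ℤ × ℤ × ℤ → ℤ} {Kx HI1 HI2 Gb Mm nr nD n₁ : ℕ} {yLo : ℤ}
    (hc : 0 < c₀) (hϱ1 : 1 ≤ ϱ) (hα : 0 < α) (hD : 0 < D) (hcB : 0 < cB) (hcB2 : 2 * cB ^ 2 ≤ lam ^ 2)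
    (haLo : 0 < aLo) (hs0 : 0 ≤ s) (hs1 : s < 1) (hτ : 0 ≤ τ) (hhLo : 0 ≤ hLo) (hhHi : 0 ≤ hHi)
    (hA : lam ^ 2 < (1 - s) ^ 2 * aLo ^ 2)
    (hAC : (1 - s) ^ 2 * τ ^ 2 * aLo ^ 4 ≤ ((1 - s) ^ 2 * aLo ^ 2 - lam ^ 2) * ((τ ^ 2 + hLo ^ 2) * aLo ^ 2 - 2 / 3 * lam ^ 2))
    (hC2 : lam ^ 2 * (τ ^ 2 + 2 / 3 * (1 - s) ^ 2) ≤ hLo ^ 2 * (1 - s) ^ 2 * aLo ^ 2) (hA' : (1 + s) ^ 2 * aHi ^ 2 < mu ^ 2)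
    (hAC' : (1 + s) ^ 2 * τ ^ 2 * aHi ^ 4 ≤ (mu ^ 2 - (1 + s) ^ 2 * aHi ^ 2) * (2 / 3 * mu ^ 2 - (τ ^ 2 + hHi ^ 2) * aHi ^ 2))
    (hΔ : hLo ≤ hHi) (hss' : s ≤ s') (hhb' : 3 * (hLo + hHi) ^ 2 ≤ 8 * (1 + s') ^ 2) (hlam : 0 < lam) (hβ : 0 < β)
    (hKa : (1 + β) * ((1 + s') * aHi / lam) ^ 2 ≤ Ka) (hηa : 6 * (1 + β⁻¹) * (aHi / lam) ^ 2 * (τ ^ 2 + (hHi - hLo) ^ 2 / 4) ≤ ηa)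
    (hgen : 2 * ((1 + s) * aHi) + ℓ₀ ≤ ϱ)
    (hT : ∀ ω : List ℤ, ω.length = 2 * H₀ + 1 → IsLetterSeq (regW ω) → IsHollowWindow (2 * H₀ + 1) ω →
      KernelSlabSoundFE H₀ R ω lo hi P9max E TRX TNX)
    (hP9 : mu ^ 2 * (P9max : ℝ) ≤ 9 * ϱ ^ 2) (hlo : mu ^ 2 * (lo : ℝ) ≤ 9 * ϱ ^ 2)
    (hKx : 0 < Kx) (slabs : List (ℤ × List (List (ℕ × ℕ)) × List ℕ))
    (hsl : ∀ sl ∈ slabs, xiSlab Kx HI1 HI2 sl.1 yLo sl.2.1 = some sl.2.2 ∧ ∀ c ∈ sl.2.1, c.length = nr)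
    (hG : 4 * HI2 < 3 * (3 * (Gb + 1) - 2) ^ 2) (hM : HI2 < 6 * (Mm + 1) * (Mm + 1))
    (hy : ∀ t : ℤ, t.natAbs ≤ Gb → yLo ≤ t ∧ t < yLo + nr)
    (hx : ∀ t : ℤ, t.natAbs ≤ Gb → ∃ sl ∈ slabs, sl.1 ≤ t ∧ t < sl.1 + sl.2.1.length)
    (h1 : (HI1 : ℤ) ≤ hi) (h2 : 9 * D ^ 2 ≤ lam ^ 2 * (HI2 : ℝ))
    (hnD : (nD : ℝ) - 1 ≤ D / ϱ) (hn2 : 2 ≤ n₁) (hnD₁ : nD ≤ n₁)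
    (hθ : ∑ n ∈ Finset.Ico nD n₁, (2 * (n : ℝ) * (n + 1) * (2 * n + 1) / 3) * (7 * (n : ℝ) / D ^ 8) +
        14 * ((n₁ : ℝ) + 1) * (2 * n₁ + 1) / (9 * cB ^ 8 * (n₁ : ℝ) ^ 2 * ((n₁ : ℝ) - 1) ^ 3) ≤ θ) :
    BoxTailDebitP s Λ c₀ ℓ₀ ϱ (InBoxWH s aLo aHi τ hLo hHi)
      (fun _ _ y => nearTableR H₀ R E α lam TRX (y.2 - y.1) +
        (1 + α) * (lam ^ 8)⁻¹ * (45927 / Kx * (slabs.map fun sl => (sl.2.2.getD (code3 (y.2 - y.1)) 0 : ℝ)).sum) + (1 + α) * θ)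
      (fun _ _ y => nearTableN H₀ R E α lam Ka ηa TRX TNX (y.2 - y.1) +
        (1 + α⁻¹) * (lam ^ 8)⁻¹ * (45927 / Kx * (slabs.map fun sl => (sl.2.2.getD (code3 (y.2 - y.1)) 0 : ℝ)).sum) + (1 + α⁻¹) * θ)
      0 := by
  have hϱ0 : 0 < ϱ := one_pos.trans_le hϱ1
  have key : ∀ (L : E3 ≃L[ℝ] E3) (w' : ℤ → E3),
      ∃ npz : ((Cell 2 × ℤ) × (Cell 2 × ℤ) → ℕ) × ((Cell 2 × ℤ) × (Cell 2 × ℤ) → ℕ → Cell 2 × ℤ),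
        InBoxWH s aLo aHi τ hLo hHi L w' →
          IsPathSystemOn ϱ (gen₁ L) (gen₂ L) w' (IdealNearF (letterOfWH s aLo aHi τ hLo hHi L w') hi) npz.1 npz.2 ∧
            SchemeDominatedOnP ϱ α (gen₁ L) (gen₂ L) w' npz.1 npz.2 (IdealNearF (letterOfWH s aLo aHi τ hLo hHi L w') hi)
              (fun y => nearTableR H₀ R E α lam TRX (y.2 - y.1)) fun y => nearTableN H₀ R E α lam Ka ηa TRX TNX (y.2 - y.1) := by
    intro L w'
    by_cases hB : InBoxWH s aLo aHi τ hLo hHi L w'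
    · obtain ⟨np, z, h⟩ := nearF_of_inBoxWH_E_hb haLo hs0 hs1 hτ hhLo hhHi hA hAC hC2 hA' hAC' hΔ hss' hhb' hlam hβ hKa hηa hϱ0.le
        hα hT hP9 hlo hB
      exact ⟨(np, z), fun _ => h⟩
    · exact ⟨(fun _ => 0, fun _ _ => (fun _ => 0, 0)), fun h => absurd h hB⟩
  choose npz hnpz using key
  exact boxTailDebitP_of_scheme hϱ1 hα hc
    (boxSchemeP_of_cover3FBox hα hcB hϱ0 hD hnD hn2 hnD₁ hθ (letterOfWH s aLo aHi τ hLo hHi) hi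
      (np₁ := fun L w' => (npz L w').1) (z₁ := fun L w' => (npz L w').2)
      (fun L w' hB => gen_sum_le_of_inBoxWH haLo.le hs0 hgen hB)
      (fun a _ L w' _ hB => isLayeredCrystal_of_inBoxW (inBoxW_of_inBoxWH hB) hcB.le hcB2 haLo hs0 hs1 hτ hhLo hhHi hA hAC hC2
        hA' hAC')
      (fun a _ L w' _ hB => hnpz L w' hB)
      (fun a _ L w' _ hB => midF_of_inBoxWH (ϱ := ϱ) haLo hs0 hs1 hτ hhLo hhHi hA hAC hC2 hA' hAC' hlam hα hKx slabs hsl hG hM hy hx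
        h1 h2 hB))

end Summit.AtomisticToContinuum.Crystallization.Theorems.ChartedZeroExcessLayeredLatticeLiouville
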